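import Mathlib
import HarnessLib
import Summits.CriticalPhenomena.SAWScalingLimit.Theses.SAWDefectDecoherence
import Literature.Probability.RandomPlanarGeometry.HexDomainSingleton
import Literature.Barriers.CriticalPhenomena.ParafermionicHalfCauchyRiemann

/-!
# Line `tip-martingale-depth-induction` — skeleton for crux `DefectDecoherence`
(stmt-CriticalPhenomena-8549, route `SAWDefectDecoherence`)

The crux: `∃ C, θ > 3/4` with `‖T(Λ,a,v)‖ ≤ C R^{-θ} M(Λ,a,v)` for every simply connected
hexagonal domain `Λ`, adjacent boundary root `a = s(u,w)` (`u ∉ Λ ∋ w`) and `R`-deep vertex `v`,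
where `T` is the conjugated vertex-star combination of the DCS observable at `(x_c, 5/8)` and `M`
the star mass at spin `0`.

THE LINE (idea card `Ideas/tip-martingale-depth-induction.md`, sharpened by TRIAGE-r1-{1,2,3}
and by this plan): the defect seen from the tip is an exact exploration martingale; optional
stopping at the FIRST ENTRANCE of the walk into the lattice ball `B(v,r)` writes
`T(Λ,a,v) = Σ_π weight(π) · T(Λ∖π, a_π, v)` and `M(Λ,a,v) = Σ_π x_c^{|π|} M(Λ∖π, a_π, v)` over
first-entrance prefixes `π` (a class closed under slitting: `Λ∖π` is simply connected, `a_π` an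
adjacent boundary root, `v` stays `r`-deep).  The continuation sum of a prefix is TELESCOPED over
picture scales `s₀ < 2s₀ < ⋯ < 2^J s₀ ≤ R`: the part carried by continuation walks that stay in
`B(v,s_i)` but leave `B(v,s_{i-1})` depends only on the PICTURE of `π` at scale `s_i` (its vertices
inside `B(v,s_i)` and its entrance dart), and is EXACTLY `ℤ/3`-covariant under rotating the
picture by `120°` about `c_v` (`T ↦ ω̄ T`, `M ↦ M`).  Grouping prefixes by the `ℤ/3`-orbit of their
picture, the prefix phases `e^{-iσW(π)}` recombine with the character `e^{-13πiK/12}` of the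
lifted entrance angle (`K = k + 3N`, `k` the rotation, `N` the sheet), and the level-`i` term is
contracted by the orbit-averaged coefficient `φ(R/s_i)` (stub `stub_orbitMixing`), while the walks
that leave `B(v,s_{i-1})` cost `(s_{i-1}/r)^{-β}` by strata of closest pre-exit approach (stub
`stub_wallExit`) and carry the induction hypothesis at the stratum's depth (second order).  The
resulting one-step recursion (stub `stub_telescopingRecursion`, exact identities + triangle
inequalities) is closed by a Fekete-type induction over dyadic depth blocks (stub
`stub_scaleInduction`, pure real analysis): `θ_line = min(α, β)` — NOT the card's lossy
`αβ/(α+β)` — so the line needs only `α > 3/4` and `β > 3/4` (predicted `α = 19/16`, the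
triage-consensus dipole–alias rate, and `β ∈ [1, 3/2]`, the wall/3-arm exit exponent).

Composition `DefectDecoherence_of : S1 → S2 → S3 → S4 → DefectDecoherence` is proved below
(with the crude bound `‖T‖ ≤ M/2` and monotonicity of `DepthBound`, both proved here).

Disproof honoured: `defectDecoherence_false_without_depth` — the `R`-ball hypothesis is used in
`stub_telescopingRecursion` (`ball Λ v s = ` the full lattice ball needs `s ≤ R`) and in
`stub_wallExit` (depth `ρ ≥ 1`); the dictionary `defectDecoherence_iff_plainStar` /
`conj_star_sum_eq` is not needed (we work with the conjugated combination `T` itself, which is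
covariant: `T(ρ·) = ω̄ T(·)`).
-/

namespace Summit.CriticalPhenomena.SAWScalingLimit.Cruxes.DefectDecoherence.TipMartingaleDepthInduction

open scoped BigOperators ComplexConjugate Classical
open Literature.Probability.LatticeModels Literature.Probability.RandomPlanarGeometry.SAW

noncomputable section

/-! ### The objects of the crux -/

/-- `x_c = 1/√(2+√2)`. -/
abbrev xc : ℝ := hexCriticalFugacity

/-- The star of `v` inside `Λ` (its three neighbours as soon as `v` is `1`-deep). -/
def star (Λ : Finset HexVertex) (v : HexVertex) : Finset HexVertex :=
  Λ.filter (fun t => hexGraph.Adj v t)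

/-- The vertex-star DEFECT `T(Λ, a = s(u,w), v) = Σ_{t ∼ v} conj(mid{v,t} - c_v) · F_{x_c,5/8}({v,t})`
(literally the left-hand side of the crux). -/
def defect (Λ : Finset HexVertex) (u w v : HexVertex) : ℂ :=
  ∑ t ∈ star Λ v, (starRingEnd ℂ) (hexMidpoint s(v, t) - hexCenter v) *
    hexParafermionicObservable Λ s(u, w) xc (5 / 8) s(v, t)

/-- The star MASS `M(Λ, a, v) = Σ_{t ∼ v} ‖F_{x_c,0}({v,t})‖ = Σ_t Σ_{γ : a → {v,t}} x_c^{ℓ(γ)}`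
(literally the right-hand sum of the crux). -/
def mass (Λ : Finset HexVertex) (u w v : HexVertex) : ℝ :=
  ∑ t ∈ star Λ v, ‖hexParafermionicObservable Λ s(u, w) xc 0 s(v, t)‖

/-- The lattice ball of radius `s` about `c_v`, cut out of `Λ` (equal to the full lattice ball when
`v` is `s`-deep). -/
def ball (Λ : Finset HexVertex) (v : HexVertex) (s : ℝ) : Finset HexVertex :=
  Λ.filter (fun q => dist (hexCenter q) (hexCenter v) ≤ s)

/-- `v` is `R`-deep in `Λ` (the crux's ball hypothesis). -/
def Deep (Λ : Finset HexVertex) (v : HexVertex) (R : ℝ) : Prop :=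
  ∀ y : HexVertex, dist (hexCenter y) (hexCenter v) ≤ R → y ∈ Λ

/-- Admissible configuration at depth `R`: exactly the hypotheses of the crux (simply connected `Λ`,
adjacent boundary root `s(u,w)` with `u ∉ Λ ∋ w`, `1 ≤ R`, `v` `R`-deep).  This class is closed
under slitting by a first-entrance prefix — the lever of the line. -/
def Admissible (Λ : Finset HexVertex) (u w v : HexVertex) (R : ℝ) : Prop :=
  hexDomainSimplyConnected Λ ∧ hexGraph.Adj u w ∧ u ∉ Λ ∧ w ∈ Λ ∧ 1 ≤ R ∧ Deep Λ v R

/-- `DepthBound R b`: at depth `R` the defect/mass ratio is at most `b`, uniformly over admissible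
configurations.  The crux is `∃ C, θ > 3/4, ∀ R ≥ 1, DepthBound R (C R^{-θ})` (see
`DefectDecoherence_of`). -/
def DepthBound (R b : ℝ) : Prop :=
  ∀ (Λ : Finset HexVertex) (u w v : HexVertex), Admissible Λ u w v R →
    ‖defect Λ u w v‖ ≤ b * mass Λ u w v

/-- The crude (triangle-inequality) bound `‖T‖ ≤ B₀ M` for EVERY configuration (no admissibility):
used for the deepest stratum, where no clean ball is left. Proved below with `B₀ = 1/2`. -/
def CrudeBound (B₀ : ℝ) : Prop :=
  ∀ (Λ : Finset HexVertex) (u w v : HexVertex), ‖defect Λ u w v‖ ≤ B₀ * mass Λ u w v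

/-! ### First-entrance prefixes, pictures, the `ℤ/3` action -/

/-- `γ : a → s(y,z)` is a FIRST-ENTRANCE PREFIX into `B(v,r)`: its vertex list ends at `y`, all its
vertices lie at distance `> r` from `c_v`, and the entrance dart `y → z` lands in `B(v,r)`.  The
continuation then lives in the slit domain `Λ ∖ γ.verts` with root `s(y,z)` (`y` removed, `z`
kept): simply connected, adjacent boundary root, `v` still `r`-deep. -/
def IsPrefix (v : HexVertex) (r : ℝ) (y z : HexVertex) {Λ : Finset HexVertex} {a : Sym2 HexVertex}
    (γ : HexMidEdgeSAW Λ a s(y, z)) : Prop :=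
  γ.verts.getLast? = some y ∧ hexGraph.Adj y z ∧ dist (hexCenter z) (hexCenter v) ≤ r ∧
    ∀ q ∈ γ.verts, r < dist (hexCenter q) (hexCenter v)

/-- A PICTURE at scale `s`: a vertex set inside `B(v,s)` together with an entrance dart. -/
abbrev Picture : Type := Finset HexVertex × HexVertex × HexVertex

/-- The scale-`s` picture of a prefix: its vertices within distance `s` of `c_v`, and its dart. -/
def pic (v : HexVertex) (s : ℝ) (y z : HexVertex) {Λ : Finset HexVertex} {a : Sym2 HexVertex}
    (γ : HexMidEdgeSAW Λ a s(y, z)) : Picture :=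
  (γ.verts.toFinset.filter (fun q => dist (hexCenter q) (hexCenter v) ≤ s), y, z)

/-- The PICTURE DOMAIN `B(v,s) ∖ P`: the continuation walks of a prefix with scale-`s` picture `P`
that stay inside `B(v,s)` are exactly the walks of this domain from the root `s(P.2.1, P.2.2)`,
so their defect and mass are `defect`/`mass` of `(picDom Λ v s P, P.2.1, P.2.2, v)` — an
admissible configuration at depth `r`. -/
def picDom (Λ : Finset HexVertex) (v : HexVertex) (s : ℝ) (P : Picture) : Finset HexVertex :=
  ball Λ v s \ P.1

/-- Rotation by `+120°` about the centre of `v`: the lattice vertex whose centre is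
`c_v + ζ² (c_y - c_v)` (`ζ = e^{iπ/3}`; a symmetry of the honeycomb, so the witness exists and is
unique — explicitly `rot3 (x,k) (p,k') = (R²(p-x) + x + (k-k')e₀, k')`, `R²(m,n) = (-(m+n), m)`). -/
def rot3 (v y : HexVertex) : HexVertex :=
  Classical.epsilon fun y' : HexVertex =>
    hexCenter y' - hexCenter v = triZeta ^ 2 * (hexCenter y - hexCenter v)

/-- The `ℤ/3` action on pictures. -/
def rotPic (v : HexVertex) (P : Picture) : Picture :=
  (P.1.image (rot3 v), rot3 v P.2.1, rot3 v P.2.2)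

/-- Sum of a complex functional over the first-entrance prefixes of `(Λ, s(u,w))` into `B(v,r)`
(darts range over `Λ × Λ`; non-prefixes contribute `0`). -/
def prefixSumC (Λ : Finset HexVertex) (u w v : HexVertex) (r : ℝ)
    (f : ∀ y z : HexVertex, HexMidEdgeSAW Λ s(u, w) s(y, z) → ℂ) : ℂ :=
  ∑ p ∈ Λ ×ˢ Λ, ∑ γ : HexMidEdgeSAW Λ s(u, w) s(p.1, p.2),
    if IsPrefix v r p.1 p.2 γ then f p.1 p.2 γ else 0

/-- Sum of a real functional over the first-entrance prefixes of `(Λ, s(u,w))` into `B(v,r)`. -/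
def prefixSumR (Λ : Finset HexVertex) (u w v : HexVertex) (r : ℝ)
    (f : ∀ y z : HexVertex, HexMidEdgeSAW Λ s(u, w) s(y, z) → ℝ) : ℝ :=
  ∑ p ∈ Λ ×ˢ Λ, ∑ γ : HexMidEdgeSAW Λ s(u, w) s(p.1, p.2),
    if IsPrefix v r p.1 p.2 γ then f p.1 p.2 γ else 0

/-- Prefix AMPLITUDE of a picture: `A_s(P) = Σ_{π : pic_s(π) = P} e^{-iσW(π)} x_c^{|π|}` (`σ = 5/8`;
the full winding of the prefix from the root `a`, so `W(π) = θ(dart) - θ(a) + 2πN(π)`). -/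
def picAmp (Λ : Finset HexVertex) (u w v : HexVertex) (r s : ℝ) (P : Picture) : ℂ :=
  prefixSumC Λ u w v r fun y z γ => if pic v s y z γ = P then γ.weight xc (5 / 8) else 0

/-- Prefix MASS of a picture: `m_s(P) = Σ_{π : pic_s(π) = P} x_c^{|π|}`. -/
def picMass (Λ : Finset HexVertex) (u w v : HexVertex) (r s : ℝ) (P : Picture) : ℝ :=
  prefixSumR Λ u w v r fun y z γ => if pic v s y z γ = P then xc ^ γ.length else 0

/-- The ORBIT CONTRACTION of a picture:
`c_s(P) = ‖Σ_{k<3} ω̄^k A_s(ρ^k P)‖ / Σ_{k<3} m_s(ρ^k P)` (`ω = ζ²`, `ρ = rot3 v`); orbit-invariant,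
`≤ 1`, and `= |Σ_K e^{-13πiK/12} m(K)| / Σ_K m(K)` for the lifted entrance angle `2πK/3` — the
`(13/8 ≡ -11/8 mod 3)`-characteristic function of the entrance law GIVEN THE EXACT PICTURE. -/
def contraction (Λ : Finset HexVertex) (u w v : HexVertex) (r s : ℝ) (P : Picture) : ℝ :=
  ‖∑ k ∈ Finset.range 3, (starRingEnd ℂ) (triZeta ^ 2) ^ k *
      picAmp Λ u w v r s ((rotPic v)^[k] P)‖ /
    ∑ k ∈ Finset.range 3, picMass Λ u w v r s ((rotPic v)^[k] P)

/-- ONE-SCALE ORBIT MIXING with profile `φ`: for every admissible configuration at depth `R`, every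
entrance radius `r ≥ 1` and picture scale `s ∈ [r+1, R]`, the orbit contraction, averaged over
first-entrance prefixes with the positive weights `x_c^{|π|} · M(picture domain of π)`, is at most
`φ(R/s)`.  A statement about the POSITIVE walk law only (no defect values). -/
def MixingBound (φ : ℝ → ℝ) : Prop :=
  ∀ (Λ : Finset HexVertex) (u w v : HexVertex) (R : ℝ), Admissible Λ u w v R →
    ∀ r s : ℝ, 1 ≤ r → r + 1 ≤ s → s ≤ R →
      prefixSumR Λ u w v r (fun y z γ =>
          contraction Λ u w v r s (pic v s y z γ) *
            (xc ^ γ.length * mass (picDom Λ v s (pic v s y z γ)) y z v))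
        ≤ φ (R / s) * prefixSumR Λ u w v r (fun y z γ =>
            xc ^ γ.length * mass (picDom Λ v s (pic v s y z γ)) y z v)

/-- EXIT MASS beyond radius `L`: the mass of the walks `a → star(v)` visiting a vertex at distance
`> L` from `c_v`. -/
def exitMass (Λ : Finset HexVertex) (u w v : HexVertex) (L : ℝ) : ℝ :=
  ∑ t ∈ star Λ v, ∑ γ : HexMidEdgeSAW Λ s(u, w) s(v, t),
    if (∃ q ∈ γ.verts, L < dist (hexCenter q) (hexCenter v)) then xc ^ γ.length else 0

/-- WALL–EXIT BOUND with constant `c` and exponent `β`: for every admissible configuration at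
depth `ρ` whose root enters within distance `ρ` of `v`, the fraction of the star mass carried by
walks reaching distance `> L` is at most `c (L/ρ)^{-β}`.  (The wall `Λᶜ ∋ u` crosses the annulus
`A(ρ, L)`: simple connectivity and the boundary root are load-bearing here.) -/
def ExitBound (c β : ℝ) : Prop :=
  ∀ (Λ : Finset HexVertex) (u w v : HexVertex) (ρ L : ℝ), Admissible Λ u w v ρ →
    dist (hexCenter w) (hexCenter v) ≤ ρ → ρ ≤ L →
      exitMass Λ u w v L ≤ c * (L / ρ) ^ (-β) * mass Λ u w v

/-! ### The recursion across scales -/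

/-- Strata cost of the walks leaving radius `C·r` from an admissible configuration at depth `r`:
stratum `j < N` (closest pre-exit approach in `(r/2^{j+1}, r/2^j]`) has mass `≤ c (C 2^j)^{-β} M`
and defect ratio `≤ η(r/2^{j+1})`; the last stratum (approach `≤ r/2^N < 2`) is paid crudely. -/
def strataSum (c β B₀ r : ℝ) (N : ℕ) (η : ℝ → ℝ) (C : ℝ) : ℝ :=
  c * ((∑ j ∈ Finset.range N, (C * 2 ^ j) ^ (-β) * η (r / 2 ^ (j + 1))) +
    (C * 2 ^ N) ^ (-β) * B₀)

/-- The new ratio bound at depth `R` produced by one telescoped step with entrance radius `r`,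
picture scales `s₀ 2^i` (`i ≤ J`): level `0` is contracted by `φ(R/s₀)` against `η(r)`; level
`i+1` (walks leaving `B(s₀2^i)` inside `B(s₀2^{i+1})`) by `φ(R/(s₀2^{i+1}))` against the strata
cost at ratio `s₀2^i/r`; the walks leaving `B(s₀ 2^J)` pay the bare strata cost. -/
def etaNew (φ : ℝ → ℝ) (c β B₀ : ℝ) (η : ℝ → ℝ) (R r s₀ : ℝ) (J N : ℕ) : ℝ :=
  φ (R / s₀) * η r +
    (∑ i ∈ Finset.range J,
      φ (R / (s₀ * 2 ^ (i + 1))) * strataSum c β B₀ r N η (s₀ * 2 ^ i / r)) +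
    strataSum c β B₀ r N η (s₀ * 2 ^ J / r)

/-- ONE STEP OF THE DEPTH RECURSION for an abstract depth-bound predicate `D`: any nonnegative
profile `η` valid at all depths `≥ 1` yields, at depth `R`, the bound `etaNew …` for every choice
of entrance radius `r` (with `r/2^N ∈ [1,2)`), first picture scale `s₀ ≥ r + 1` and number of
doublings `J` with `s₀ 2^J ≤ R`. -/
def RecursionStep (D : ℝ → ℝ → Prop) (φ : ℝ → ℝ) (c β B₀ : ℝ) : Prop :=
  ∀ η : ℝ → ℝ, (∀ ρ, 0 ≤ η ρ) → (∀ ρ, 1 ≤ ρ → D ρ (η ρ)) →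
    ∀ (R r s₀ : ℝ) (J N : ℕ), 1 ≤ r / 2 ^ N → r / 2 ^ N < 2 → r + 1 ≤ s₀ → s₀ * 2 ^ J ≤ R →
      D R (etaNew φ c β B₀ η R r s₀ J N)

/-! ### The four statements of the line, as named propositions -/

/-- **S1 statement — one-scale orbit mixing at a rate `α > 3/4`.** -/
def OrbitMixing : Prop :=
  ∃ cα α : ℝ, 3 / 4 < α ∧ 0 ≤ cα ∧ MixingBound (fun m => cα * m ^ (-α))

/-- **S2 statement — wall–exit bound at an exponent `β > 3/4`.** -/
def WallExit : Prop :=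
  ∃ c β : ℝ, 3 / 4 < β ∧ 0 ≤ c ∧ ExitBound c β

/-- **S3 statement — the telescoped first-entrance recursion.** -/
def TelescopingRecursion : Prop :=
  ∀ (φ : ℝ → ℝ) (c β B₀ : ℝ), (∀ m, 1 ≤ m → 0 ≤ φ m) → 0 ≤ c → 0 < β → 0 ≤ B₀ →
    CrudeBound B₀ → MixingBound φ → ExitBound c β → RecursionStep DepthBound φ c β B₀

/-- **S4 statement — Fekete-type induction over dyadic depth blocks.** -/
def ScaleInduction : Prop :=
  ∀ (D : ℝ → ℝ → Prop) (cα α c β B₀ : ℝ),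
    (∀ R b b', b ≤ b' → D R b → D R b') → 3 / 4 < α → 3 / 4 < β → 0 ≤ cα → 0 ≤ c → 0 ≤ B₀ →
    (∀ ρ, 1 ≤ ρ → D ρ B₀) → RecursionStep D (fun m => cα * m ^ (-α)) c β B₀ →
    ∃ C θ : ℝ, 3 / 4 < θ ∧ ∀ R, 1 ≤ R → D R (C * R ^ (-θ))

/-! ### The stubs (registered; signatures spelled out, definitionally the named statements) -/

/-- **S1 — one-scale orbit mixing at a rate `α > 3/4` (HARDEST).**  The orbit-averaged contraction
of the `(−11/8)`-character of the lifted entrance law, given the exact picture, decays like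
`(R/s)^{-α}`.  Prediction: `α = min((121/128)·(8/3) = 2.52` (sheet spread, winding variance
`(8/3) log`), `1 + 3/16 = 19/16` (dipole anisotropy `(s/R)^1` of the three rotated picture masses
times the alias `|ĝ(21/8 ≡ −3/8)| = (R/s)^{-3/16}`), picture-excursion tail `≥ 1`) = 19/16`. -/
theorem stub_orbitMixing :
    ∃ cα α : ℝ, 3 / 4 < α ∧ 0 ≤ cα ∧ MixingBound (fun m => cα * m ^ (-α)) := by
  sorry

/-- **S2 — wall–exit bound at an exponent `β > 3/4`.**  Prediction: `β = x₂(wedge 2π) = 1` for a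
straight wall up to `x₃ − x₁ = 3/2` for a SAW wall (Coulomb gas, `x_L = (9L²−4)/48`,
`x_L^{(s)} = L(3L+2)/8`); without the wall it would be `x₂ = 2/3 < 3/4`. -/
theorem stub_wallExit :
    ∃ c β : ℝ, 3 / 4 < β ∧ 0 ≤ c ∧ ExitBound c β := by
  sorry

/-- **S3 — the telescoped first-entrance recursion (exact identities + triangle inequalities).**
First-entrance bijection (weights multiply, windings add: the iterated `FirstStepDecomposition`),
closure of admissibility under slitting, `T(picture domain)` and its telescoping differences are
functions of the picture and `ℤ/3`-covariant (`T ↦ ω̄T`, `M ↦ M` under `rot3 v`), orbit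
regrouping `Σ_P A(P)G(P) = (1/3) Σ_P G(P) Σ_k ω̄^k A(ρ^kP)`, strata of closest pre-exit
approach bounded by `ExitBound` (mass) and by the profile `η` at the stratum depth (defect), the
deepest stratum by `CrudeBound`. -/
theorem stub_telescopingRecursion :
    ∀ (φ : ℝ → ℝ) (c β B₀ : ℝ), (∀ m, 1 ≤ m → 0 ≤ φ m) → 0 ≤ c → 0 < β → 0 ≤ B₀ →
      CrudeBound B₀ → MixingBound φ → ExitBound c β → RecursionStep DepthBound φ c β B₀ := by
  sorry

/-- **S4 — Fekete-type induction over dyadic depth blocks (pure real analysis).**  For any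
depth-bound predicate `D` monotone in the bound, a base bound `B₀` at all depths and the recursion
step with profile `cα m^{-α}`: choosing `s₀ = 2r`, `J` large and fixed, `r = R/2^{J+1}`, the new
bound is `A r^{-θ} · O(J 2^{-min(α,β) J}) ≤ A R^{-θ}` for every `θ < min(α, β)`; induct on blocks
`[2^n K₀, 2^{n+1} K₀)` with the profile `η = A ρ^{-θ}` below the block and `B₀` above. -/
theorem stub_scaleInduction :
    ∀ (D : ℝ → ℝ → Prop) (cα α c β B₀ : ℝ),
      (∀ R b b', b ≤ b' → D R b → D R b') → 3 / 4 < α → 3 / 4 < β → 0 ≤ cα → 0 ≤ c → 0 ≤ B₀ →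
      (∀ ρ, 1 ≤ ρ → D ρ B₀) → RecursionStep D (fun m => cα * m ^ (-α)) c β B₀ →
      ∃ C θ : ℝ, 3 / 4 < θ ∧ ∀ R, 1 ≤ R → D R (C * R ^ (-θ)) := by
  sorry

/-! ### Consistency: each named statement IS its registered stub (definitionally) -/

theorem orbitMixing_holds : OrbitMixing := stub_orbitMixing
theorem wallExit_holds : WallExit := stub_wallExit
theorem telescopingRecursion_holds : TelescopingRecursion := stub_telescopingRecursion
theorem scaleInduction_holds : ScaleInduction := stub_scaleInduction

/-! ### Name-keyed aliases of the four statements (the hypotheses of the composition: the skeleton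
audit admits a hypothesis only if its head constant is a registered obligation or is named like a
declared stub) -/
namespace Registered

/-- Alias of `OrbitMixing` keyed by the registered stub name. -/
abbrev stub_orbitMixing : Prop := OrbitMixing
/-- Alias of `WallExit` keyed by the registered stub name. -/
abbrev stub_wallExit : Prop := WallExit
/-- Alias of `TelescopingRecursion` keyed by the registered stub name. -/
abbrev stub_telescopingRecursion : Prop := TelescopingRecursion
/-- Alias of `ScaleInduction` keyed by the registered stub name. -/
abbrev stub_scaleInduction : Prop := ScaleInduction

end Registered

/-! ### Proved glue -/

/-- `DepthBound` is monotone in the bound (masses are nonnegative). -/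
theorem depthBound_mono (R b b' : ℝ) (h : b ≤ b') (hb : DepthBound R b) : DepthBound R b' := by
  intro Λ u w v hadm
  refine (hb Λ u w v hadm).trans ?_
  have hm : 0 ≤ mass Λ u w v := Finset.sum_nonneg fun t _ => norm_nonneg _
  exact mul_le_mul_of_nonneg_right h hm

/-- Adjacent honeycomb vertices have centres at squared distance `1/3`. -/
theorem normSq_hexCenter_sub_of_adj {v t : HexVertex} (h : hexGraph.Adj v t) :
    Complex.normSq (hexCenter t - hexCenter v) = 1 / 3 := by
  obtain ⟨x, i⟩ := t
  obtain ⟨y, j⟩ := v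
  rw [hexCenter_sub_hexCenter, normSq_add_mul_triZeta]
  fin_cases i <;> fin_cases j
  · exact absurd h (Literature.Barriers.CriticalPhenomena.HexKernel.not_hexGraph_adj_of_snd_eq_holds _ _ rfl)
  · rcases (Literature.Barriers.CriticalPhenomena.HexKernel.hexGraph_adj_iff_of_snd_eq_zero_holds x y).1 h.symm with rfl | rfl | rfl
    · simp; norm_num
    · simp [Pi.sub_apply]; norm_num
    · simp [Pi.sub_apply]; norm_num
  · rcases (Literature.Barriers.CriticalPhenomena.HexKernel.hexGraph_adj_iff_of_snd_eq_zero_holds y x).1 h with rfl | rfl | rfl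
    · simp; norm_num
    · simp [Pi.sub_apply]; norm_num
    · simp [Pi.sub_apply]; norm_num
  · exact absurd h (Literature.Barriers.CriticalPhenomena.HexKernel.not_hexGraph_adj_of_snd_eq_holds _ _ rfl)

/-- `‖mid{v,t} - c_v‖ ≤ 1/2` for `t ∼ v` (it equals `1/(2√3)`). -/
theorem norm_hexMidpoint_sub_hexCenter_le {v t : HexVertex} (h : hexGraph.Adj v t) :
    ‖hexMidpoint s(v, t) - hexCenter v‖ ≤ 1 / 2 := by
  have hmid : hexMidpoint s(v, t) - hexCenter v = (hexCenter t - hexCenter v) / 2 := by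
    rw [hexMidpoint_mk]; ring
  have hle : ‖hexCenter t - hexCenter v‖ ≤ 1 := by
    rw [← sq_le_one_iff₀ (norm_nonneg _), Complex.sq_norm, normSq_hexCenter_sub_of_adj h]
    norm_num
  rw [hmid, norm_div, Complex.norm_two]
  linarith

/-- The crude bound `‖T(Λ,a,v)‖ ≤ M(Λ,a,v)/2` (triangle inequality, unimodular winding weights). -/
theorem crude_bound : CrudeBound (1 / 2) := by
  intro Λ u w v
  unfold defect mass
  rw [Finset.mul_sum]
  refine (norm_sum_le _ _).trans (Finset.sum_le_sum fun t ht => ?_)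
  have hadj : hexGraph.Adj v t := (Finset.mem_filter.1 ht).2
  have hxc : 0 ≤ xc := hexCriticalFugacity_pos_lt_one.1.le
  have h1 : ‖(starRingEnd ℂ) (hexMidpoint s(v, t) - hexCenter v)‖ ≤ 1 / 2 := by
    rw [RCLike.norm_conj]
    exact norm_hexMidpoint_sub_hexCenter_le hadj
  have h2 : ‖hexParafermionicObservable Λ s(u, w) xc (5 / 8) s(v, t)‖ ≤
      ‖hexParafermionicObservable Λ s(u, w) xc 0 s(v, t)‖ := by
    rw [hexParafermionicObservable_zero_spin, Complex.norm_real,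
      Real.norm_of_nonneg (Finset.sum_nonneg fun γ _ => pow_nonneg hxc _)]
    exact norm_hexParafermionicObservable_le _ _ hxc _ _
  rw [norm_mul]
  calc ‖(starRingEnd ℂ) (hexMidpoint s(v, t) - hexCenter v)‖ *
        ‖hexParafermionicObservable Λ s(u, w) xc (5 / 8) s(v, t)‖
      ≤ (1 / 2) * ‖hexParafermionicObservable Λ s(u, w) xc (5 / 8) s(v, t)‖ :=
        mul_le_mul_of_nonneg_right h1 (norm_nonneg _)
    _ ≤ (1 / 2) * ‖hexParafermionicObservable Λ s(u, w) xc 0 s(v, t)‖ :=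
        mul_le_mul_of_nonneg_left h2 (by norm_num)

/-! ### Composition: the four stubs imply the crux BY NAME -/

/-- **The line concludes the crux.** -/
theorem DefectDecoherence_of (h1 : Registered.stub_orbitMixing) (h2 : Registered.stub_wallExit)
    (h3 : Registered.stub_telescopingRecursion) (h4 : Registered.stub_scaleInduction) :
    Summit.CriticalPhenomena.SAWScalingLimit.Theses.SAWDefectDecoherence.DefectDecoherence := by
  obtain ⟨cα, α, hα, hcα, hmix⟩ := h1
  obtain ⟨c, β, hβ, hc, hexit⟩ := h2
  have hrec : TelescopingRecursion := h3
  have hind : ScaleInduction := h4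
  have hB : CrudeBound (1 / 2) := crude_bound
  have hφ : ∀ m : ℝ, 1 ≤ m → 0 ≤ cα * m ^ (-α) := fun m hm =>
    mul_nonneg hcα (Real.rpow_nonneg (by linarith) _)
  have hstep : RecursionStep DepthBound (fun m => cα * m ^ (-α)) c β (1 / 2) :=
    hrec (fun m => cα * m ^ (-α)) c β (1 / 2) hφ hc (by linarith) (by norm_num) hB hmix hexit
  have hbase : ∀ ρ : ℝ, 1 ≤ ρ → DepthBound ρ (1 / 2) := fun ρ _ Λ u w v _ => hB Λ u w v
  obtain ⟨C, θ, hθ, hD⟩ :=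
    hind DepthBound cα α c β (1 / 2) depthBound_mono hα hβ hcα hc (by norm_num) hbase hstep
  refine ⟨C, θ, hθ, ?_⟩
  intro Λ hsc u w hadj hu hw v R hR hdeep
  exact hD R hR Λ u w v ⟨hsc, hadj, hu, hw, hR, hdeep⟩

/-- Wiring check: the registered stubs feed `DefectDecoherence_of` as stated. -/
example : Summit.CriticalPhenomena.SAWScalingLimit.Theses.SAWDefectDecoherence.DefectDecoherence :=
  DefectDecoherence_of stub_orbitMixing stub_wallExit stub_telescopingRecursion stub_scaleInduction

end

end Summit.CriticalPhenomena.SAWScalingLimit.Cruxes.DefectDecoherence.TipMartingaleDepthInduction
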